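import Summits.ValiantsHypothesis.ValiantsHypothesis.Theorems.SymPencilPerFourPairingDiscSixNormal
import Summits.ValiantsHypothesis.ValiantsHypothesis.Theorems.SymPencilSdcPerFourCellTenSixShapes

/-!
# Route `SymPencil` — the pairing discriminant on a six-dimensional two-row space, ONTO CASES:
# if one row is onto `K⁴` then the other row lies in a coordinate plane
# (towards leaf 5 `stub_twoLineFilter`; `--supports` stmt-ValiantsHypothesis-5674
# `SdcSuperquadratic`; rung currency only, nothing here bears on `VP ≠ VNP`)

Coordinates on `K⁸ = K^{Fin 4 ⊕ Fin 4}`: `α_i = Y (inl i)`, `β_i = Y (inr i)`; `A·B = 4Π` is the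
vanishing of the pairing discriminant (`SymPencilPerFourPairingDiscTools`).

**Theorem** (`inr_pair_vanish_of_onto`, CASE I).  Let `V' ≤ K⁸` be `6`-dimensional with
`A·B = 4Π` on `V'` and `α : V' → K⁴` onto.  Then `β_m ≡ β_{m'} ≡ 0` on `V'` for two indices
`m ≠ m'` (so `V' = K⁴ × span(e_n, e_{n'})`, the `W₂`-type).  Proof: the `β`-kernel
`B₀ = {b : (0;b) ∈ V'}` is `2`-dimensional; by the top-coefficient lemma
(`SymPencilPerFourPairingDiscSixNormal.disc_vanish_of_section`) `A·B = 4Π` at `(α; b)` for ALL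
`α`, so every `b ∈ B₀` has two zero coordinates (`two_zeros_of_disc_vanish`), `B₀` is a coordinate
plane `span(e_n, e_{n'})` (`exists_pair_of_forall_two_zeros`, `single_mem_of_le_pair`), and after
relabelling the columns by a permutation `σ` with `σ 2 = n`, `σ 3 = n'` (`disc_comp_perm`, the
discriminant is `S₄`-invariant) the normalised onto case `inr_zero_one_vanish` applies.
CASE II (`inl_pair_vanish_of_onto`): `β` onto ⇒ `α_m ≡ α_{m'} ≡ 0`, by the row swap
(`disc_comp_swap`).

Honest framing: lemmas; `27 ≤ sdc(per₄) ≤ 29` unchanged, stmt-5674 open, `VP ≠ VNP` not moved, no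
summit statement is proved here.  No definitions, no named facts. [folklore]
-/

noncomputable section

-- single-conjunct layout: Sub = Summit, duplicated namespace component intended
set_option linter.dupNamespace false

namespace Summit.ValiantsHypothesis.ValiantsHypothesis.Theorems.SymPencilPerFourPairingDiscSixOnto

open Matrix Finset Module Polynomial
open Literature.Computability.AlgebraicComplexity.AlperBogartVelasco
open Summit.ValiantsHypothesis.ValiantsHypothesis.Theorems.SymPencilPerFourPairingHyperplane
open Summit.ValiantsHypothesis.ValiantsHypothesis.Theorems.SymPencilPerFourPairingDiscTools
open Summit.ValiantsHypothesis.ValiantsHypothesis.Theorems.SymPencilPerFourPairingDiscSixNormal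
open Summit.ValiantsHypothesis.ValiantsHypothesis.Theorems.SymPencilSdcPerFourCellTenSixShapes

variable {K : Type*} [Field K]

/-! ### Symmetries of the discriminant -/

/-- `Σ_j Π_i` terms are invariant under a simultaneous permutation of the index. [folklore] -/
theorem sum_prod_ite_comp_perm (σ : Equiv.Perm (Fin 4)) (f g : Fin 4 → K) :
    (∑ j, ∏ i, if i = j then f (σ i) else g (σ i)) = ∑ j, ∏ i, if i = j then f i else g i := by
  have h1 : (∑ j, ∏ i, if i = j then f (σ i) else g (σ i)) =
      ∑ j, ∏ i, if σ i = σ j then f (σ i) else g (σ i) := by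
    refine Finset.sum_congr rfl fun j _ => Finset.prod_congr rfl fun i _ => ?_
    simp only [σ.injective.eq_iff]
  rw [h1]
  have h2 : ∀ j, (∏ i, if σ i = σ j then f (σ i) else g (σ i)) =
      ∏ i, if i = σ j then f i else g i := fun j =>
    Equiv.prod_comp σ (fun i => if i = σ j then f i else g i)
  simp_rw [h2]
  exact Equiv.sum_comp σ (fun j' => ∏ i, if i = j' then f i else g i)

/-- **`S₄`-invariance**: the discriminant identity for `Y ∘ (σ ⊕ σ)` is the one for `Y`.
[folklore] -/
theorem disc_comp_perm (σ : Equiv.Perm (Fin 4)) (Y : Fin 4 ⊕ Fin 4 → K) :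
    ((∑ j, ∏ i, if i = j then (Y ∘ Equiv.sumCongr σ σ) (Sum.inl i)
        else (Y ∘ Equiv.sumCongr σ σ) (Sum.inr i)) *
      (∑ j, ∏ i, if i = j then (Y ∘ Equiv.sumCongr σ σ) (Sum.inr i)
        else (Y ∘ Equiv.sumCongr σ σ) (Sum.inl i)) =
      4 * ∏ i, (Y ∘ Equiv.sumCongr σ σ) (Sum.inl i) * (Y ∘ Equiv.sumCongr σ σ) (Sum.inr i)) ↔
    ((∑ j, ∏ i, if i = j then Y (Sum.inl i) else Y (Sum.inr i)) *
      (∑ j, ∏ i, if i = j then Y (Sum.inr i) else Y (Sum.inl i)) =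
      4 * ∏ i, Y (Sum.inl i) * Y (Sum.inr i)) := by
  simp only [Function.comp_apply, Equiv.sumCongr_apply, Sum.map_inl, Sum.map_inr]
  rw [sum_prod_ite_comp_perm σ (fun i => Y (Sum.inl i)) (fun i => Y (Sum.inr i)),
    sum_prod_ite_comp_perm σ (fun i => Y (Sum.inr i)) (fun i => Y (Sum.inl i)),
    Equiv.prod_comp σ (fun i => Y (Sum.inl i) * Y (Sum.inr i))]

/-- **Row swap**: the discriminant identity for `Y ∘ swap` is the one for `Y`. [folklore] -/
theorem disc_comp_swap (Y : Fin 4 ⊕ Fin 4 → K) :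
    ((∑ j, ∏ i, if i = j then (Y ∘ Equiv.sumComm (Fin 4) (Fin 4)) (Sum.inl i)
        else (Y ∘ Equiv.sumComm (Fin 4) (Fin 4)) (Sum.inr i)) *
      (∑ j, ∏ i, if i = j then (Y ∘ Equiv.sumComm (Fin 4) (Fin 4)) (Sum.inr i)
        else (Y ∘ Equiv.sumComm (Fin 4) (Fin 4)) (Sum.inl i)) =
      4 * ∏ i, (Y ∘ Equiv.sumComm (Fin 4) (Fin 4)) (Sum.inl i) *
        (Y ∘ Equiv.sumComm (Fin 4) (Fin 4)) (Sum.inr i)) ↔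
    ((∑ j, ∏ i, if i = j then Y (Sum.inl i) else Y (Sum.inr i)) *
      (∑ j, ∏ i, if i = j then Y (Sum.inr i) else Y (Sum.inl i)) =
      4 * ∏ i, Y (Sum.inl i) * Y (Sum.inr i)) := by
  simp only [Function.comp_apply, Equiv.sumComm_apply, Sum.swap_inl, Sum.swap_inr]
  rw [mul_comm (∑ j, ∏ i, if i = j then Y (Sum.inr i) else Y (Sum.inl i))]
  simp_rw [mul_comm (Y (Sum.inr _)) (Y (Sum.inl _))]

/-- Two indices complementary to a given pair. [folklore] -/
theorem exists_compl_pair (m m' : Fin 4) (h : m ≠ m') :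
    ∃ n n' : Fin 4, n ≠ n' ∧ n ≠ m ∧ n ≠ m' ∧ n' ≠ m ∧ n' ≠ m' := by
  revert m m'
  decide

/-! ### Case I: `α` onto -/

/-- **CASE I.**  See the module docstring. [folklore] -/
theorem inr_pair_vanish_of_onto [CharZero K] (V' : Submodule K (Fin 4 ⊕ Fin 4 → K))
    (h6 : finrank K V' = 6)
    (hdisc : ∀ Y ∈ V',
      (∑ j, ∏ i, if i = j then Y (Sum.inl i) else Y (Sum.inr i)) *
        (∑ j, ∏ i, if i = j then Y (Sum.inr i) else Y (Sum.inl i)) =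
        4 * ∏ i, Y (Sum.inl i) * Y (Sum.inr i))
    (honto : ∀ α : Fin 4 → K, ∃ Y ∈ V', ∀ i, Y (Sum.inl i) = α i) :
    ∃ m m' : Fin 4, m ≠ m' ∧ ∀ Y ∈ V', Y (Sum.inr m) = 0 ∧ Y (Sum.inr m') = 0 := by
  classical
  -- the projections
  let πα : (Fin 4 ⊕ Fin 4 → K) →ₗ[K] (Fin 4 → K) := LinearMap.funLeft K K Sum.inl
  let πβ : (Fin 4 ⊕ Fin 4 → K) →ₗ[K] (Fin 4 → K) := LinearMap.funLeft K K Sum.inr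
  have hπα : ∀ Y i, πα Y i = Y (Sum.inl i) := fun _ _ => rfl
  have hπβ : ∀ Y i, πβ Y i = Y (Sum.inr i) := fun _ _ => rfl
  -- `α` onto: `V'.map πα = ⊤`
  have htop : V'.map πα = ⊤ := by
    refine Submodule.eq_top_iff'.2 fun α => ?_
    obtain ⟨Y, hY, hYα⟩ := honto α
    exact ⟨Y, hY, funext fun i => hYα i⟩
  -- the `β`-kernel `Kβ` and its row space `B₀`, both `2`-dimensional
  set Kβ : Submodule K (Fin 4 ⊕ Fin 4 → K) := V' ⊓ LinearMap.ker πα with hKβ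
  have memKβ : ∀ k, k ∈ Kβ ↔ k ∈ V' ∧ ∀ i, k (Sum.inl i) = 0 := fun k => by
    rw [hKβ, Submodule.mem_inf, LinearMap.mem_ker]
    exact ⟨fun h => ⟨h.1, fun i => by simpa [hπα] using congr_fun h.2 i⟩,
      fun h => ⟨h.1, funext fun i => h.2 i⟩⟩
  have hKβ2 : finrank K Kβ = 2 := by
    have h := finrank_eq_finrank_map_add_finrank_inf_ker V' πα
    rw [htop, finrank_top, Module.finrank_fintype_fun_eq_card, Fintype.card_fin, h6] at h
    rw [hKβ]
    omega
  set B₀ : Submodule K (Fin 4 → K) := Kβ.map πβ with hB₀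
  have hB₀2 : finrank K B₀ = 2 := by
    have h := finrank_eq_finrank_map_add_finrank_inf_ker Kβ πβ
    have hbot : (Kβ ⊓ LinearMap.ker πβ : Submodule K _) = ⊥ := by
      refine (Submodule.eq_bot_iff _).2 fun k hk => ?_
      rw [Submodule.mem_inf, memKβ, LinearMap.mem_ker] at hk
      funext c
      rcases c with i | i
      · exact hk.1.2 i
      · simpa [hπβ] using congr_fun hk.2 i
    rw [hbot, finrank_bot, hKβ2] at h
    rw [hB₀]
    omega
  -- every `b ∈ B₀` kills the discriminant for ALL `α`, hence has two zero coordinates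
  have hz : ∀ b ∈ B₀, ∃ m m' : Fin 4, m ≠ m' ∧ b m = 0 ∧ b m' = 0 := by
    intro b hb
    rw [hB₀, Submodule.mem_map] at hb
    obtain ⟨k, hk, rfl⟩ := hb
    obtain ⟨hkV, hk0⟩ := (memKβ k).1 hk
    refine two_zeros_of_disc_vanish (πβ k) fun α => ?_
    obtain ⟨Y, hY, hYα⟩ := honto α
    have h := disc_vanish_of_section V' hdisc hY hkV hk0
    simp only [hYα] at h
    simpa [hπβ] using h
  obtain ⟨m, m', hmm, hB₀le⟩ := exists_pair_of_forall_two_zeros B₀ hz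
  obtain ⟨n, n', hnn, hnm, hnm', hn'm, hn'm'⟩ := exists_compl_pair m m' hmm
  -- the unit vectors `e_{βn}, e_{βn'}` lie in `V'`
  have hunit : ∀ c : Fin 4, c ≠ m → c ≠ m' →
      (Pi.single (Sum.inr c) 1 : Fin 4 ⊕ Fin 4 → K) ∈ V' := by
    intro c hcm hcm'
    have hc : (Pi.single c 1 : Fin 4 → K) ∈ B₀ := single_mem_of_le_pair B₀ hB₀2 hmm hB₀le c hcm hcm'
    rw [hB₀, Submodule.mem_map] at hc
    obtain ⟨k, hk, hkc⟩ := hc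
    obtain ⟨hkV, hk0⟩ := (memKβ k).1 hk
    have hk_eq : k = Pi.single (Sum.inr c) 1 := by
      funext d
      rcases d with i | i
      · rw [hk0 i, Pi.single_eq_of_ne (Sum.inl_ne_inr) _]
      · have := congr_fun hkc i
        rw [hπβ] at this
        rw [this]
        by_cases hic : i = c
        · subst hic; simp
        · rw [Pi.single_eq_of_ne hic, Pi.single_eq_of_ne (fun h => hic (Sum.inr_injective h))]
    rw [← hk_eq]
    exact hkV
  -- relabel the columns: `σ 2 = n`, `σ 3 = n'`
  obtain ⟨σ, hσ2, hσ3⟩ := exists_perm_apply_eq 2 3 n n' (by decide) hnn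
  set e : Fin 4 ⊕ Fin 4 ≃ Fin 4 ⊕ Fin 4 := Equiv.sumCongr σ σ with he
  set Φ : (Fin 4 ⊕ Fin 4 → K) ≃ₗ[K] (Fin 4 ⊕ Fin 4 → K) := LinearEquiv.funCongrLeft K K e with hΦ
  have hΦa : ∀ Y, Φ Y = Y ∘ e := fun Y => rfl
  set V'' : Submodule K (Fin 4 ⊕ Fin 4 → K) := V'.map Φ.toLinearMap with hV''
  have memV'' : ∀ Z, Z ∈ V'' ↔ ∃ Y ∈ V', Z = Y ∘ e := fun Z => by
    rw [hV'', Submodule.mem_map]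
    exact ⟨fun ⟨Y, hY, hYZ⟩ => ⟨Y, hY, by rw [← hYZ]; rfl⟩,
      fun ⟨Y, hY, hYZ⟩ => ⟨Y, hY, by rw [hYZ]; rfl⟩⟩
  have hdisc'' : ∀ Z ∈ V'',
      (∑ j, ∏ i, if i = j then Z (Sum.inl i) else Z (Sum.inr i)) *
        (∑ j, ∏ i, if i = j then Z (Sum.inr i) else Z (Sum.inl i)) =
        4 * ∏ i, Z (Sum.inl i) * Z (Sum.inr i) := by
    intro Z hZ
    obtain ⟨Y, hY, rfl⟩ := (memV'' Z).1 hZ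
    exact (disc_comp_perm σ Y).2 (hdisc Y hY)
  have honto'' : ∀ α : Fin 4 → K, ∃ Z ∈ V'', ∀ i, Z (Sum.inl i) = α i := by
    intro α
    obtain ⟨Y, hY, hYα⟩ := honto (fun i => α (σ.symm i))
    refine ⟨Y ∘ e, (memV'' _).2 ⟨Y, hY, rfl⟩, fun i => ?_⟩
    simp [he, hYα]
  have hsingle : ∀ c : Fin 4,
      (Pi.single (Sum.inr (σ c)) (1 : K) : Fin 4 ⊕ Fin 4 → K) ∘ e = Pi.single (Sum.inr c) 1 := by
    intro c
    funext d
    rcases d with i | i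
    · simp [he]
    · by_cases hic : i = c
      · subst hic; simp [he]
      · simp [he, hic, σ.injective.eq_iff]
  have h2 : (Pi.single (Sum.inr 2) 1 : Fin 4 ⊕ Fin 4 → K) ∈ V'' :=
    (memV'' _).2 ⟨_, hunit (σ 2) (by rw [hσ2]; exact hnm) (by rw [hσ2]; exact hnm'),
      (hsingle 2).symm⟩
  have h3 : (Pi.single (Sum.inr 3) 1 : Fin 4 ⊕ Fin 4 → K) ∈ V'' :=
    (memV'' _).2 ⟨_, hunit (σ 3) (by rw [hσ3]; exact hn'm) (by rw [hσ3]; exact hn'm'),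
      (hsingle 3).symm⟩
  have hvan := inr_zero_one_vanish V'' hdisc'' honto'' h2 h3
  refine ⟨σ 0, σ 1, fun h => absurd (σ.injective h) (by decide), fun Y hY => ?_⟩
  have h := hvan (Y ∘ e) ((memV'' _).2 ⟨Y, hY, rfl⟩)
  simpa [he] using h

/-! ### Case II: `β` onto -/

/-- **CASE II** (the row swap of Case I): if `β : V' → K⁴` is onto then `α_m ≡ α_{m'} ≡ 0` for
two indices `m ≠ m'`. [folklore] -/
theorem inl_pair_vanish_of_onto [CharZero K] (V' : Submodule K (Fin 4 ⊕ Fin 4 → K))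
    (h6 : finrank K V' = 6)
    (hdisc : ∀ Y ∈ V',
      (∑ j, ∏ i, if i = j then Y (Sum.inl i) else Y (Sum.inr i)) *
        (∑ j, ∏ i, if i = j then Y (Sum.inr i) else Y (Sum.inl i)) =
        4 * ∏ i, Y (Sum.inl i) * Y (Sum.inr i))
    (honto : ∀ β : Fin 4 → K, ∃ Y ∈ V', ∀ i, Y (Sum.inr i) = β i) :
    ∃ m m' : Fin 4, m ≠ m' ∧ ∀ Y ∈ V', Y (Sum.inl m) = 0 ∧ Y (Sum.inl m') = 0 := by
  classical
  set e : Fin 4 ⊕ Fin 4 ≃ Fin 4 ⊕ Fin 4 := Equiv.sumComm (Fin 4) (Fin 4) with he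
  set Φ : (Fin 4 ⊕ Fin 4 → K) ≃ₗ[K] (Fin 4 ⊕ Fin 4 → K) := LinearEquiv.funCongrLeft K K e with hΦ
  set V'' : Submodule K (Fin 4 ⊕ Fin 4 → K) := V'.map Φ.toLinearMap with hV''
  have memV'' : ∀ Z, Z ∈ V'' ↔ ∃ Y ∈ V', Z = Y ∘ e := fun Z => by
    rw [hV'', Submodule.mem_map]
    exact ⟨fun ⟨Y, hY, hYZ⟩ => ⟨Y, hY, by rw [← hYZ]; rfl⟩,
      fun ⟨Y, hY, hYZ⟩ => ⟨Y, hY, by rw [hYZ]; rfl⟩⟩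
  have h6'' : finrank K V'' = 6 := by rw [hV'', LinearEquiv.finrank_map_eq, h6]
  have hdisc'' : ∀ Z ∈ V'',
      (∑ j, ∏ i, if i = j then Z (Sum.inl i) else Z (Sum.inr i)) *
        (∑ j, ∏ i, if i = j then Z (Sum.inr i) else Z (Sum.inl i)) =
        4 * ∏ i, Z (Sum.inl i) * Z (Sum.inr i) := by
    intro Z hZ
    obtain ⟨Y, hY, rfl⟩ := (memV'' Z).1 hZ
    exact (disc_comp_swap Y).2 (hdisc Y hY)
  have honto'' : ∀ α : Fin 4 → K, ∃ Z ∈ V'', ∀ i, Z (Sum.inl i) = α i := by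
    intro α
    obtain ⟨Y, hY, hYα⟩ := honto α
    exact ⟨Y ∘ e, (memV'' _).2 ⟨Y, hY, rfl⟩, fun i => by simp [he, hYα]⟩
  obtain ⟨m, m', hmm, hvan⟩ := inr_pair_vanish_of_onto V'' h6'' hdisc'' honto''
  refine ⟨m, m', hmm, fun Y hY => ?_⟩
  have h := hvan (Y ∘ e) ((memV'' _).2 ⟨Y, hY, rfl⟩)
  simpa [he] using h

end Summit.ValiantsHypothesis.ValiantsHypothesis.Theorems.SymPencilPerFourPairingDiscSixOnto

end
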